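import Summits.BirchSwinnertonDyer.BirchSwinnertonDyer.Theorems.SignedLowerHalvesSprungLowerHalfAtThreeCharacterization
import Literature.NumberTheory.EllipticCurves.JetchevSkinnerWan2017.AnticyclotomicControlGeneral
import Literature.NumberTheory.EllipticCurves.AnticyclotomicPConverseLinks
import Literature.NumberTheory.EllipticCurves.BSDSelmerPConverseRankOneRubinProofs
import HarnessLib

/-!
# Route `SignedLowerHalves`, crux `SprungLowerHalfAtThree` (item stmt-BirchSwinnertonDyer-19003): the Λ-free
# clause (conv₀) «X8 ∧ `Sel_{3^∞}(E/ℚ)` finite ⇒ `r_an = 0`» on the ANTICYCLOTOMIC Greenberg–Selmer road —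
# an `a_p`-BLIND road (relaxed/strict conditions at the primes above `3`, no `±`/`♯♭` theory, no
# Beilinson–Flach class, no use of Wan's withdrawn arXiv:1411.6352) — typed ON THE TREE'S REAL OBJECTS
# (`AcSelmer.XAc`, `padicLogPoint`, `LDerivEK`), the control link DISCHARGED BY NAME from the PUBLISHED
# Jetchev–Skinner–Wan 2017 Thm. 3.3.1 + (3.5.d) (`p ≥ 3`, any good `p`: `p = 3`, `a_3 = ±3` in scope), the
# two analytic links displayed at the datum (cell `bsd-ssimc`, seat `bsd-ssimc-k3-c5` gen 7, object
# «X8-AC0»; a `--supports … --as helper` file; theorems only; closes nothing)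

PARTITION (cell bsd-ssimc): X8 (A8) ∩ {N square-free} × p = 3 — types-the-object-of (clause (conv₀) of
crux 5, by p417882/p421771 `SprungLowerHalfAtThree` ⟺ Modularity ∧ (conv₀) ∧ (low₀)); closes NONE; 0
census moves; nothing booked; BSD is not proved by any of this.

## The road (standard BDP-type `p`-converse architecture, transposed to RANK ZERO and to `(3, ±3)`)

For `W` on class X8 (`p = 3` good supersingular, `a_3 = ±3`) with `Sel_{3^∞}(E/ℚ)` finite:
1. `rank E(ℚ) = 0` and `Ш(E/ℚ)[3^∞]` finite (Greenberg's corank identity, tree theorems); by the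
   `p`-parity theorem the root number is `+1`, so every Heegner-type imaginary quadratic `K` has
   `w(E^{d_K}) = −1` — the twist supply (Bump–Friedberg–Hoffstein 1990 / Murty–Murty 1991, root-number form,
   with `3` split) is NOT in this file: the auxiliary field is a DATUM (`K`, `3` split, `ord_{s=1} L(E^{d_K},s)
   = 1`).
2. Over `K`: `rank E(K) = 0 + 1 = 1`, `corank Sel_{3^∞}(E/K) = 0 + 1`, hence `Ш(E/K)[3^∞]` finite
   (GZK for the twist + the tree's quadratic base-change identities) — `rankOne_data_baseChange`.
3. CONTROL (PUBLISHED, by name, `p = 3` verbatim inside «`p ≥ 3`, `p ∤ N`», no ordinarity):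
   `JetchevSkinnerWan2017.thm331_anticyclotomicControl_general` ⇒ `𝔛 = X_ac(E[3^∞]/K_∞)` (strict at the
   prime `v` of `ι`, relaxed at `v̄`, `AcSelmer.XAc (W.baseChange K) 3 κ v ∅ γ`) is `Λ`-torsion with a
   generator `𝓕`, `𝓕(0) ≠ 0`.
4. DIVISIBILITY ∘ BDP FORMULA at the datum, in NON-VANISHING currency (displayed binder `hdiv`): every
   generator has `𝓕(0) ∈ ℚ_3 · log_ω(P_K)²` for the datum's point `P_K ∈ E(K)`. In print this is the
   composite of (a) the Greenberg-type divisibility `char(𝔛)Λ^ur ⊂ (𝓛_𝔭^BDP)` in `Λ^ur[1/p]` = Castella–Liu–Wan,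
   Forum Math. Sigma 10 (2022) e110, **Thm. 8.2.1 (1)** [«`p ≥ 3` split in K», §5.2: weight 2, `π_v` unramified
   or Steinberg ∀ `v` (N square-free), `π_p` unramified (ANY `a_p`: «the modular form is not assumed to be
   ordinary at `p`»), a prime `q ∣ N` non-split in `K` (and `2 ∣ N` if `2` is non-split), `ρ̄∣G_K` irreducible
   «automatically true if `π` is not ordinary at `p`»] carried to the anticyclotomic line as in Castella–Wan,
   Math. Ann. 389 (2024) §5, Thm. 5.3, (5.2)–(5.5) [printed under §2's blanket `p ≥ 5`], and (b) the
   Bertolini–Darmon–Prasanna formula `𝓛^BDP(𝟙) = c · log_ω(P_K)²` (BDP 2013 Thm. 5.13 / Castella–Hsieh 2018 at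
   good `p ∤ 2N`; Brooks 2015 on `X_{N⁺,N⁻}`): `p^k 𝓕 = 𝓛 · a` and `𝓛(𝟙) = c · log²` give `𝓕(0) = (a(0)c/p^k) ·
   log²`. The scalar may vanish: only `⊂` is used (Castella–Wan footnote 4).
5. GROSS–ZAGIER at the datum (displayed binder `hGZ`): `P_K` of infinite order ⇒ `L'(E/K,1) ≠ 0` (GZ86 /
   Yuan–Zhang–Zhang 2013 / Cai–Shu–Tian 2014 Thm. 1.5 for the Heegner point of `X₀(N)` resp. `X_{N⁺,N⁻}`).
6. PROVED here: 3 ∧ 4 ⇒ `log_ω(P_K) ≠ 0` ⇒ `P_K` non-torsion (a torsion point has vanishing formal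
   logarithm, `padicLogPoint_formalIndex_smul_eq_zero_of_isOfFinAddOrder`) ⇒ (5) `L'(E/K,1) ≠ 0` ⇒
   `ord_{s=1} L(E/K,s) ≤ 1`; Artin factorisation `ord L(E/K) = ord L(E) + ord L(E^{d_K})` with the twist
   term `1` forces `ord_{s=1} L(E,s) = 0`.

WHY THE K-DATUM IS LEFT ABSTRACT (honest): CLW22's engine needs a prime `q ∣ N` NON-SPLIT in `K`, while the
tree's typed BDP-formula / Gross–Zagier facts at a good prime (`CastellaGrossiLeeSkinner2022.
thm513_exists_isBDPLFunction_valueAtOne`, `gross_zagier`) carry the CLASSICAL Heegner hypothesis (every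
`ℓ ∣ N` split): the two printed halves of link 4∘5 live at DIFFERENT fields unless one uses the
generalised-Heegner versions (a ramified `q`, or `N⁻ = q₁q₂` on a Shimura curve). So links 4 and 5 are
displayed AT THE DATUM — exactly the pattern of `Literature/…/AnticyclotomicPConverseLinks.lean` (cell
bsd-cn100) — and the seat's MEMO-7 locates each half in print input by input. Link 3 is NOT displayed: it is
the published JSW theorem BY NAME, whose printed scope («`p ≥ 3`», «`p` a prime of good reduction», no
hypothesis on the primes of `N` in `K`, no ordinarity) contains `(3, ±3)` verbatim.

What this is NOT: not (low₀) (the Eisenstein half proper — on this road it would need the OPPOSITE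
divisibility at `a_3 = ±3`, i.e. `±/♯♭` Heegner classes, not in print); not a claim that (conv₀) is a
theorem (two displayed links + the twist datum remain); not a per-pair record; the crux stays OPEN.

Contents: §1 descent lemmas (PROVED); §2 the Heegner step `not_isOfFinAddOrder_of_control_of_charValueInLogSq`
(PROVED; `a_p`-blind); §3 `X8.analyticRank_eq_zero_of_finite_selmer_of_acLinks` — (conv₀) at a datum from
the links, control by name; §4 `X8.conv0_of_acRoad` (the (conv₀) binder of
`sprungLowerHalfAtThree_of_corankZero_inputs` fed by the road) and
`sprungLowerHalfAtThree_of_acRoad_of_low0` (the ROUTE DECL BY NAME ⟸ modularity ∧ period unit ∧ GZK ∧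
entire `L` ∧ the road ∧ (low₀)).

References: [JetchevSkinnerWan2017] Thm. 3.3.1 + (3.5.d); [CastellaLiuWan2022] = Forum Math. Sigma 10
(2022) e110, §1, §5.2, Thm. 8.2.1; [CastellaWan2023] Math. Ann. 389 (2024) §2, §5 Thm. 5.3, Thm. 6.11 and
footnote 4; [BertoliniDarmonPrasanna2013] Thm. 5.13; [CastellaGrossiLeeSkinner2022] Thm. 5.1.3, §5.2;
[GrossZagier1986] I.(6.3); [CaiShuTian2014] Thm. 1.1/1.5; [DokchitserDokchitserAnnals2010] Thm. 1.4;
[MurtyMurty1991] Cor. p. 449; [GreenbergLNM1716] §1; [Darmon2004] Thm. 3.22.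
-/

set_option autoImplicit false
set_option linter.dupNamespace false

noncomputable section

open scoped Classical NumberField

open WeierstrassCurve IsDedekindDomain Literature.NumberTheory.EllipticCurves
  Literature.NumberTheory.EllipticCurves.Rank1Residual
  Literature.NumberTheory.EllipticCurves.Rank1Residual.Typed
  Literature.NumberTheory.EllipticCurves.Castella2018
  Literature.NumberTheory.EllipticCurves.AcPConverseLinks

namespace Summit.BirchSwinnertonDyer.BirchSwinnertonDyer.Theorems.X8AnticyclotomicConverse

/-! ### §1. Descent bookkeeping (PROVED from tree theorems; nothing specific to `(3, ±3)`) -/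

/-- **Finite `Sel_{p^∞}(E/ℚ)` ⇒ rank `0` and `Ш(E/ℚ)[p^∞]` finite** — Greenberg's corank identity
`corank Sel_{p^∞} = rank + corank Ш[p^∞]` (tree theorems `selmerCorank_eq_mordellWeilRank_add_holds`,
`finite_primaryComponent_sha_iff_shaCorank_eq_zero`). [cite: GreenbergLNM1716, §1 p. 54] -/
theorem rank_zero_and_finite_sha_of_finite_selmer {K : Type} [Field K] [NumberField K]
    (W : WeierstrassCurve K) [W.IsElliptic] (p : ℕ) [Fact p.Prime]
    (hfin : Finite (W.selmerGroupPInfty p)) :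
    W.mordellWeilRank = 0 ∧ Finite (AddCommGroup.primaryComponent W.sha p) := by
  haveI := hfin
  have h0 : W.selmerCorank p = 0 := W.selmerCorank_eq_zero_of_finite p
  have h := W.selmerCorank_eq_mordellWeilRank_add_holds p
  refine ⟨by omega, ?_⟩
  rw [finite_primaryComponent_sha_iff_shaCorank_eq_zero W p]
  omega

/-- **A curve of positive Mordell–Weil rank over a number field has a point of infinite order**
(`E(K)` is finitely generated — Mordell–Weil, tree `module_finite_point_holds` — and a finitely generated
`ℤ`-module all of whose elements are torsion has `ℤ`-rank `0`, `Module.finrank_eq_zero_iff_isTorsion`).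
[cite: SilvermanAEC2009, Thm. VIII.6.7] -/
theorem exists_not_isOfFinAddOrder_of_mordellWeilRank_ne_zero {K : Type} [Field K] [NumberField K]
    (W : WeierstrassCurve K) [W.IsElliptic] (h : W.mordellWeilRank ≠ 0) :
    ∃ P : W.toAffine.Point, ¬ IsOfFinAddOrder P := by
  by_contra hall
  push Not at hall
  haveI : Module.Finite ℤ W.toAffine.Point := W.module_finite_point_holds
  apply h
  unfold WeierstrassCurve.mordellWeilRank
  rw [Module.finrank_eq_zero_iff_isTorsion]
  intro P
  obtain ⟨n, hn, hnP⟩ := (hall P).exists_nsmul_eq_zero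
  refine ⟨⟨(n : ℤ), mem_nonZeroDivisors_of_ne_zero (by exact_mod_cast hn.ne')⟩, ?_⟩
  simp [natCast_zsmul, hnP]

/-- **The rank-one data over the auxiliary field.** For `E/ℚ` with `rank E(ℚ) = 0` and `Ш(E/ℚ)[p^∞]`
finite, and an imaginary quadratic `K` whose twist `E^{(d_K)}` has `rank 1` and finite `Ш[p^∞]`:
`rank E(K) = 1`, `corank_{ℤ_p} Sel_{p^∞}(E/K) = 1` and `Ш(E/K)[p^∞]` finite — the tree's quadratic
base-change identities `mordellWeilRank_baseChange_quadratic_holds`, `selmerCorank_baseChange_quadratic_holds`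
and Greenberg's identity over `K` (the mirror image of `rank_corank_sha_baseChange_of_twist_L_one_ne_zero`,
where the twist is the rank-zero factor). [cite: GreenbergLNM1716, §1 pp. 54–57]
[cite: JetchevSkinnerWan2017, §7.4.1 (arXiv:1512.06894 p. 30)] -/
theorem rankOne_data_baseChange {K : Type} [Field K] [NumberField K] (W : WeierstrassCurve ℚ)
    [W.IsElliptic] (p : ℕ) [Fact p.Prime] (hK : IsImaginaryQuadratic K)
    (hrk : W.mordellWeilRank = 0) (hsha : Finite (AddCommGroup.primaryComponent W.sha p))
    [(W.quadraticTwist (NumberField.discr K : ℚ)).IsElliptic]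
    (hrkd : (W.quadraticTwist (NumberField.discr K : ℚ)).mordellWeilRank = 1)
    (hshad : Finite (AddCommGroup.primaryComponent (W.quadraticTwist (NumberField.discr K : ℚ)).sha p)) :
    (W.baseChange K).mordellWeilRank = 1 ∧ (W.baseChange K).selmerCorank p = 1 ∧
      Finite (AddCommGroup.primaryComponent (W.baseChange K).sha p) := by
  haveI : (W.baseChange K).IsElliptic := by rw [baseChange]; infer_instance
  have hrkK : (W.baseChange K).mordellWeilRank = 1 := by
    rw [mordellWeilRank_baseChange_quadratic_holds W K hK.1, hrk, hrkd]
  have hcor0 : W.selmerCorank p = 0 := by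
    have h := W.selmerCorank_eq_mordellWeilRank_add_holds p
    have hs : W.shaCorank p = 0 := (finite_primaryComponent_sha_iff_shaCorank_eq_zero W p).1 hsha
    omega
  have hcord : (W.quadraticTwist (NumberField.discr K : ℚ)).selmerCorank p = 1 :=
    selmerCorank_eq_one_of_mordellWeilRank_eq_one_of_finite _ p hrkd hshad
  have hcorK : (W.baseChange K).selmerCorank p = 1 := by
    rw [selmerCorank_baseChange_quadratic_holds W K hK.1 p, hcor0, hcord]
  refine ⟨hrkK, hcorK, ?_⟩
  rw [finite_primaryComponent_sha_iff_shaCorank_eq_zero (W.baseChange K) p]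
  have h := (W.baseChange K).selmerCorank_eq_mordellWeilRank_add_holds p
  omega

/-! ### §2. The Heegner step: control ∧ (divisibility ∘ BDP) force the point to be non-torsion (PROVED) -/

/-- **Control ∧ «`𝓕(0) ∈ ℚ_p · log_ω(P)²`» ⇒ `P` has infinite order** — the non-vanishing-currency form of
step (4) of every BDP-type `p`-converse (Castella–Grossi–Lee–Skinner 2022 §5.2; Castella–Wan 2024 Thm. 6.10
with footnote 4 «only the divisibility ⊆ … is needed»): if `𝔛 = X_ac` has SOME generator `𝓕_A` with
`𝓕_A(0) ≠ 0` (the conclusion shape of the control theorem) and SOME generator `𝓕_B` with `𝓕_B(0) = c ·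
(log_W(z(m₀ • P_ι))/m₀)²` for a scalar `c ∈ ℚ_p` (possibly zero — the shape delivered by a ONE-SIDED
divisibility `char(𝔛)Λ^ur ⊂ (𝓛)` in `Λ^ur[1/p]` composed with a `p`-adic Waldspurger formula `𝓛(𝟙) = c′·log²`),
then `P` is not torsion: two generators of one principal ideal of the domain `Λ = ℤ_p⟦T⟧` differ by a unit
(`AcSelmer.valuation_constantCoeff_eq_of_span_singleton_eq`), so `𝓕_B(0) ≠ 0`, so `log ≠ 0`, which fails
for a torsion point (`padicLogPoint_formalIndex_smul_eq_zero_of_isOfFinAddOrder`). Weaker hypothesis than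
`AcPConverseLinks.not_isOfFinAddOrder_of_links` (no `u ≠ 0`). No height, no regulator.
[cite: CastellaWan2023, Thm. 6.10 and footnote 4 (authors' MS p. 32)]
[cite: CastellaGrossiLeeSkinner2022, §5.2 (proof of Thm. 5.2.1)] [cite: SilvermanAEC2009, IV.6.4 and VII.2.2] -/
theorem not_isOfFinAddOrder_of_control_of_charValueInLogSq {K : Type} [Field K] [NumberField K]
    (W : WeierstrassCurve ℚ) [W.IsElliptic] [W.IsGloballyMinimal] (p : ℕ) [Fact p.Prime]
    (κ : ZpExtension K p) (𝔭 : HeightOneSpectrum (𝓞 K)) (γ : Field.absoluteGaloisGroup K)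
    [Fact (κ.IsTopGenerator γ)] (ι : K →+* ℚ_[p]) (P : (W.baseChange K).toAffine.Point)
    (hA : ∃ F : IwasawaAlgebra p,
      AcSelmer.XAc.charIdeal (W.baseChange K) p κ 𝔭 ∅ γ = Ideal.span {F} ∧
        PowerSeries.constantCoeff F ≠ 0)
    (hB : ∀ F : IwasawaAlgebra p,
      AcSelmer.XAc.charIdeal (W.baseChange K) p κ 𝔭 ∅ γ = Ideal.span {F} →
        ∃ c : ℚ_[p], ((PowerSeries.constantCoeff F : ℤ_[p]) : ℚ_[p]) =
          c * ((W.baseChange ℚ_[p]).padicLogPoint (formalIndex W p • padicPointOf W p ι P) /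
            (formalIndex W p : ℚ_[p])) ^ 2) :
    ¬ IsOfFinAddOrder P := by
  intro hPtor
  obtain ⟨F, hF, hF0⟩ := hA
  obtain ⟨c, hval⟩ := hB F hF
  rw [padicLogPoint_formalIndex_smul_eq_zero_of_isOfFinAddOrder W p ι hPtor, zero_div,
    zero_pow two_ne_zero, mul_zero] at hval
  exact hF0 (PadicInt.coe_eq_zero.mp hval)

/-! ### §3. (conv₀) on X8 at an anticyclotomic datum, control BY NAME -/

/-- **(conv₀) on class X8 — «`Sel_{3^∞}(E/ℚ)` finite ⇒ `ord_{s=1} L(E,s) = 0`» — from the anticyclotomic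
links at ONE datum, the control link DISCHARGED by the PUBLISHED Jetchev–Skinner–Wan 2017 Thm. 3.3.1 +
(3.5.d) (`h331`, by name; printed scope «`p ≥ 3`», «`p` a prime of good reduction», any imaginary
quadratic `K` with `p` split, no ordinarity — `p = 3`, `a_3 = ±3` INSIDE), GZK for the twist (`hGZK`) and
the entire continuation (`hE`).** DATUM: an imaginary quadratic `K` with `3` split
(`SatisfiesHeegnerHypothesis 3 K`) whose twist `E^{(d_K)}` has analytic rank `1` (twist supply = BFH 1990 /
Murty–Murty 1991 in root-number form, NOT supplied here); `E[3]∣G_K` irreducible (`hirrK`; automatic at a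
supersingular `3` split in `K` — Fontaine/Edixhoven, CLW22 §5.2 «automatically true if π is not ordinary
at p» — carried as a binder exactly as the tree's JSW consumers do); an embedding `ι : K ↪ ℚ_3` with its
prime `v`, the anticyclotomic `κ` with topological generator `γ`; a point `P_K ∈ E(K)` carrying the two
DISPLAYED analytic links: `hdiv` = [Greenberg-type divisibility `char(X_ac)Λ^ur ⊂ (𝓛^BDP)` in `Λ^ur[1/3]`
(Castella–Liu–Wan 2022 Thm. 8.2.1 (1), PUBLISHED, «p ≥ 3», any `a_p`, N square-free, a `q ∣ N` non-split in
`K`; anticyclotomic line as in Castella–Wan 2024 Thm. 5.3, printed `p ≥ 5`) ∘ BDP formula at `𝟙`] in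
non-vanishing currency, and `hGZ` = Gross–Zagier/YZZ «`P_K` non-torsion ⇒ `L'(E/K,1) ≠ 0`». PROOF: §1 gives
rank-one data over `K`; `h331` gives a generator `𝓕` of `char X_ac` with `𝓕(0) ≠ 0`; §2 gives `P_K`
non-torsion; `hGZ` gives `L'(E/K,1) ≠ 0`, so `ord L(E/K) ≤ 1 = ord L(E) + 1` (`analyticRankEK_eq_add_of`).
CONDITIONAL on the displayed links and the datum; closes nothing; BSD is not proved by any of this.
[cite: JetchevSkinnerWan2017, Thm. 3.3.1 with §3.5 (3.5.d) (arXiv:1512.06894 pp. 11, 16)]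
[cite: CastellaLiuWan2022, Thm. 8.2.1 (1) and §5.2 (arXiv:2109.08375 p0055 L19–20, p0023 L20–31)]
[cite: CastellaWan2023, Thm. 5.3 and (5.2)–(5.5), Thm. 6.11 with footnote 4 (authors' MS pp. 23–24, 32–33)]
[cite: BertoliniDarmonPrasanna2013, Thm. 5.13] [cite: GrossZagier1986, I.(6.3)]
[cite: Darmon2004, Thm. 3.22] [cite: GreenbergLNM1716, §1 p. 54] -/
theorem X8.analyticRank_eq_zero_of_finite_selmer_of_acLinks
    (h331 : JetchevSkinnerWan2017.thm331_anticyclotomicControl_general)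
    (hGZK : rank_eq_analyticRank_of_analyticRank_le_one) (hE : hasEntireLFunction_rat)
    (W : WeierstrassCurve ℚ) [W.IsElliptic] [W.IsGloballyMinimal] (hX : ClassX8 W 3)
    (hfin : Finite (W.selmerGroupPInfty 3))
    (K : Type) [Field K] [NumberField K] (hK : IsImaginaryQuadratic K)
    (hsplit : SatisfiesHeegnerHypothesis 3 K)
    (htw : (W.quadraticTwist (NumberField.discr K : ℚ)).analyticRank = 1)
    (hirrK : (W.baseChange K).HasIrreducibleModPGaloisRep 3)
    (ι : K →+* ℚ_[3]) (v : HeightOneSpectrum (𝓞 K)) (hv : ∀ x : 𝓞 K, x ∈ v.asIdeal ↔ ‖ι (x : K)‖ < 1)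
    (κ : ZpExtension K 3) (hκ : κ.IsAnticyclotomic) (γ : Field.absoluteGaloisGroup K)
    [Fact (κ.IsTopGenerator γ)] (PK : (W.baseChange K).toAffine.Point)
    (hdiv : ∀ F : IwasawaAlgebra 3,
      AcSelmer.XAc.charIdeal (W.baseChange K) 3 κ v ∅ γ = Ideal.span {F} →
        ∃ c : ℚ_[3], ((PowerSeries.constantCoeff F : ℤ_[3]) : ℚ_[3]) =
          c * ((W.baseChange ℚ_[3]).padicLogPoint (formalIndex W 3 • padicPointOf W 3 ι PK) /
            (formalIndex W 3 : ℚ_[3])) ^ 2)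
    (hGZ : ¬ IsOfFinAddOrder PK → LDerivEK W K ≠ 0) :
    W.analyticRank = 0 := by
  -- §1 over `ℚ`: rank `0`, `Ш[3^∞]` finite
  obtain ⟨hrk, hsha⟩ := rank_zero_and_finite_sha_of_finite_selmer W 3 hfin
  -- the twist: GZK at analytic rank `1`
  have hd : (NumberField.discr K : ℚ) ≠ 0 := by exact_mod_cast NumberField.discr_ne_zero K
  haveI := W.isElliptic_quadraticTwist hd
  obtain ⟨hrkd', hshad'⟩ := hGZK (W.quadraticTwist (NumberField.discr K : ℚ)) (by omega)
  have hrkd : (W.quadraticTwist (NumberField.discr K : ℚ)).mordellWeilRank = 1 := hrkd'.trans htw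
  haveI := hshad'
  have hshad : Finite (AddCommGroup.primaryComponent
      (W.quadraticTwist (NumberField.discr K : ℚ)).sha 3) := inferInstance
  -- §1 over `K`: rank `1`, `Ш(E/K)[3^∞]` finite, a point of infinite order
  haveI : (W.baseChange K).IsElliptic := by rw [baseChange]; infer_instance
  obtain ⟨hrkK, -, hshaK⟩ := rankOne_data_baseChange W 3 hK hrk hsha hrkd hshad
  obtain ⟨P, hP⟩ := exists_not_isOfFinAddOrder_of_mordellWeilRank_ne_zero (W.baseChange K)
    (by omega)
  -- link (C): the PUBLISHED anticyclotomic control theorem, by name, at `p = 3`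
  obtain ⟨-, F, hF, hF0, -⟩ := h331 W 3 le_rfl hX.2.1.1 K hK hsplit hirrK ι v hv κ hκ γ hrkK hshaK P hP
  -- §2: the datum's point is non-torsion, then Gross–Zagier at the datum
  have hPK : ¬ IsOfFinAddOrder PK :=
    not_isOfFinAddOrder_of_control_of_charValueInLogSq W 3 κ v γ ι PK ⟨F, hF, hF0⟩ hdiv
  have hLd : LDerivEK W K ≠ 0 := hGZ hPK
  -- `ord L(E/K) ≤ 1` and Artin factorisation
  have hEKle : analyticRankEK W K ≤ 1 := by
    by_contra h2
    exact hLd (lDerivEK_eq_zero_of_two_le_analyticRankEK W K (hE W) (hE _) (by omega))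
  have hadd := analyticRankEK_eq_add_of hE W K
  omega

/-- **The same with the printed conclusion «`L(E,1) ≠ 0`»** (`r_an = 0 ⟺ L(E,1) ≠ 0` on the entire
continuation, tree `analyticRank_eq_zero_iff_holds`). CONDITIONAL as above; closes nothing.
[cite: JetchevSkinnerWan2017, Thm. 3.3.1 with §3.5 (3.5.d)] [cite: CastellaLiuWan2022, Thm. 8.2.1 (1)] -/
theorem X8.entireLFunction_one_ne_zero_of_finite_selmer_of_acLinks
    (h331 : JetchevSkinnerWan2017.thm331_anticyclotomicControl_general)
    (hGZK : rank_eq_analyticRank_of_analyticRank_le_one) (hE : hasEntireLFunction_rat)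
    (W : WeierstrassCurve ℚ) [W.IsElliptic] [W.IsGloballyMinimal] (hX : ClassX8 W 3)
    (hfin : Finite (W.selmerGroupPInfty 3))
    (K : Type) [Field K] [NumberField K] (hK : IsImaginaryQuadratic K)
    (hsplit : SatisfiesHeegnerHypothesis 3 K)
    (htw : (W.quadraticTwist (NumberField.discr K : ℚ)).analyticRank = 1)
    (hirrK : (W.baseChange K).HasIrreducibleModPGaloisRep 3)
    (ι : K →+* ℚ_[3]) (v : HeightOneSpectrum (𝓞 K)) (hv : ∀ x : 𝓞 K, x ∈ v.asIdeal ↔ ‖ι (x : K)‖ < 1)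
    (κ : ZpExtension K 3) (hκ : κ.IsAnticyclotomic) (γ : Field.absoluteGaloisGroup K)
    [Fact (κ.IsTopGenerator γ)] (PK : (W.baseChange K).toAffine.Point)
    (hdiv : ∀ F : IwasawaAlgebra 3,
      AcSelmer.XAc.charIdeal (W.baseChange K) 3 κ v ∅ γ = Ideal.span {F} →
        ∃ c : ℚ_[3], ((PowerSeries.constantCoeff F : ℤ_[3]) : ℚ_[3]) =
          c * ((W.baseChange ℚ_[3]).padicLogPoint (formalIndex W 3 • padicPointOf W 3 ι PK) /
            (formalIndex W 3 : ℚ_[3])) ^ 2)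
    (hGZ : ¬ IsOfFinAddOrder PK → LDerivEK W K ≠ 0) :
    W.entireLFunction 1 ≠ 0 :=
  (W.analyticRank_eq_zero_iff_holds (hE W)).1
    (X8.analyticRank_eq_zero_of_finite_selmer_of_acLinks h331 hGZK hE W hX hfin K hK hsplit htw hirrK
      ι v hv κ hκ γ PK hdiv hGZ)

/-! ### §4. Feeding the crux: the (conv₀) binder of `sprungLowerHalfAtThree_of_corankZero_inputs` -/

/-- **The road supplies the (conv₀) binder of the crux's characterisation.** If for every X8 curve with
finite `Sel_{3^∞}(E/ℚ)` there EXISTS an anticyclotomic datum carrying the two displayed links (the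
∀∃-hypothesis `hroad` — in print: twist supply BFH/MM in root-number form with `3` split; CLW22 Thm. 8.2.1 at a
(gen-H) field ∘ BDP/Brooks formula; GZ/YZZ), then — granted the PUBLISHED control theorem `h331`, GZK and the
entire continuation — (conv₀) holds on ALL of X8 in exactly the binder shape `hconv` of
`Theorems.sprungLowerHalfAtThree_of_corankZero_inputs` (p421771). Pure logic over §3. CONDITIONAL; closes
nothing. [cite: JetchevSkinnerWan2017, Thm. 3.3.1 with §3.5 (3.5.d)] [cite: CastellaLiuWan2022, Thm. 8.2.1 (1)] -/
theorem X8.conv0_of_acRoad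
    (h331 : JetchevSkinnerWan2017.thm331_anticyclotomicControl_general)
    (hGZK : rank_eq_analyticRank_of_analyticRank_le_one) (hE : hasEntireLFunction_rat)
    (hroad : ∀ (W : WeierstrassCurve ℚ) [W.IsElliptic] [W.IsGloballyMinimal],
      ClassX8 W 3 → Finite (W.selmerGroupPInfty 3) →
      ∃ (K : Type) (_ : Field K) (_ : NumberField K) (_ : IsImaginaryQuadratic K)
        (_ : SatisfiesHeegnerHypothesis 3 K)
        (_ : (W.quadraticTwist (NumberField.discr K : ℚ)).analyticRank = 1)
        (_ : (W.baseChange K).HasIrreducibleModPGaloisRep 3)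
        (ι : K →+* ℚ_[3]) (v : HeightOneSpectrum (𝓞 K))
        (_ : ∀ x : 𝓞 K, x ∈ v.asIdeal ↔ ‖ι (x : K)‖ < 1)
        (κ : ZpExtension K 3) (_ : κ.IsAnticyclotomic) (γ : Field.absoluteGaloisGroup K)
        (_ : Fact (κ.IsTopGenerator γ)) (PK : (W.baseChange K).toAffine.Point),
        (∀ F : IwasawaAlgebra 3,
          AcSelmer.XAc.charIdeal (W.baseChange K) 3 κ v ∅ γ = Ideal.span {F} →
            ∃ c : ℚ_[3], ((PowerSeries.constantCoeff F : ℤ_[3]) : ℚ_[3]) =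
              c * ((W.baseChange ℚ_[3]).padicLogPoint (formalIndex W 3 • padicPointOf W 3 ι PK) /
                (formalIndex W 3 : ℚ_[3])) ^ 2) ∧
        (¬ IsOfFinAddOrder PK → LDerivEK W K ≠ 0)) :
    ∀ (W : WeierstrassCurve ℚ) [W.IsElliptic] [W.IsGloballyMinimal],
      ClassX8 W 3 → Finite (W.selmerGroupPInfty 3) → W.analyticRank = 0 := by
  intro W _ _ hX hfin
  obtain ⟨K, _, _, hK, hsplit, htw, hirrK, ι, v, hv, κ, hκ, γ, hγ, PK, hdiv, hGZ⟩ := hroad W hX hfin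
  haveI := hγ
  exact X8.analyticRank_eq_zero_of_finite_selmer_of_acLinks h331 hGZK hE W hX hfin K hK hsplit htw hirrK
    ι v hv κ hκ γ PK hdiv hGZ

/-- **The ROUTE DECL BY NAME from the road.** Granted the PUBLISHED facts — modularity (`hmodE`), the
period-ratio unit at `3` (`hper`), GZK (`hGZK`), the entire continuation (`hmod`), the Jetchev–Skinner–Wan
control theorem (`h331`) — the anticyclotomic road `hroad` (links displayed, ∀∃ over X8) and the OPEN
Eisenstein input (low₀) «X8 ∧ `r_an = 0` ⇒ `ord_3 #Ш_an ≤ ord_3 #Ш`» (`hlow`), the crux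
`Theses.SignedLowerHalves.SprungLowerHalfAtThree` holds: `Theorems.sprungLowerHalfAtThree_of_corankZero_inputs`
(p421771) with its (conv₀) binder fed by `X8.conv0_of_acRoad`. So on this road crux 5 ⟺ Modularity ∧ (road
links) ∧ (low₀): the Λ-free converse clause no longer rests on `±`/`♯♭`/Beilinson–Flach engines. CONDITIONAL;
(low₀) and the links are OPEN and NOT claimed; closes nothing; BSD is not proved by any of this.
[cite: JetchevSkinnerWan2017, Thm. 3.3.1 with §3.5 (3.5.d)] [cite: CastellaLiuWan2022, Thm. 8.2.1 (1)]
[cite: Sprung2017, Thm. 1.12 and Cor. 4.11] [cite: DiamondShurman2005, Thm. 8.8.3] -/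
theorem sprungLowerHalfAtThree_of_acRoad_of_low0 (hmodE : ModularForms.exists_isNewformOf)
    (hper : realPeriodRat_eq_unit_mul_plusPeriod_three)
    (hGZK : rank_eq_analyticRank_of_analyticRank_le_one) (hmod : hasEntireLFunction_rat)
    (h331 : JetchevSkinnerWan2017.thm331_anticyclotomicControl_general)
    (hroad : ∀ (W : WeierstrassCurve ℚ) [W.IsElliptic] [W.IsGloballyMinimal],
      ClassX8 W 3 → Finite (W.selmerGroupPInfty 3) →
      ∃ (K : Type) (_ : Field K) (_ : NumberField K) (_ : IsImaginaryQuadratic K)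
        (_ : SatisfiesHeegnerHypothesis 3 K)
        (_ : (W.quadraticTwist (NumberField.discr K : ℚ)).analyticRank = 1)
        (_ : (W.baseChange K).HasIrreducibleModPGaloisRep 3)
        (ι : K →+* ℚ_[3]) (v : HeightOneSpectrum (𝓞 K))
        (_ : ∀ x : 𝓞 K, x ∈ v.asIdeal ↔ ‖ι (x : K)‖ < 1)
        (κ : ZpExtension K 3) (_ : κ.IsAnticyclotomic) (γ : Field.absoluteGaloisGroup K)
        (_ : Fact (κ.IsTopGenerator γ)) (PK : (W.baseChange K).toAffine.Point),
        (∀ F : IwasawaAlgebra 3,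
          AcSelmer.XAc.charIdeal (W.baseChange K) 3 κ v ∅ γ = Ideal.span {F} →
            ∃ c : ℚ_[3], ((PowerSeries.constantCoeff F : ℤ_[3]) : ℚ_[3]) =
              c * ((W.baseChange ℚ_[3]).padicLogPoint (formalIndex W 3 • padicPointOf W 3 ι PK) /
                (formalIndex W 3 : ℚ_[3])) ^ 2) ∧
        (¬ IsOfFinAddOrder PK → LDerivEK W K ≠ 0))
    (hlow : ∀ (W : WeierstrassCurve ℚ) [W.IsElliptic] [W.IsGloballyMinimal],
      ClassX8 W 3 → W.analyticRank = 0 → MissingLowerBoundAt W 3) :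
    Summit.BirchSwinnertonDyer.BirchSwinnertonDyer.Theses.SignedLowerHalves.SprungLowerHalfAtThree :=
  Summit.BirchSwinnertonDyer.BirchSwinnertonDyer.Theorems.sprungLowerHalfAtThree_of_corankZero_inputs
    hmodE hper hGZK hmod (X8.conv0_of_acRoad h331 hGZK hmod hroad) hlow

end Summit.BirchSwinnertonDyer.BirchSwinnertonDyer.Theorems.X8AnticyclotomicConverse

end
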